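import Literature.Analysis.FluidPDE.RusinSverakLeraySolutionsProofs
import Literature.Analysis.FluidPDE.KatoLocalL3Exists
import HarnessLib

/-!
# Kato's weighted `L^∞` bound of mild `L³` solutions: discharge of `kato_solution_le_div_sqrt`

Analysis/FluidPDE proof file (no definitions, no named facts) **discharging the named fact R**
`Literature.Analysis.FluidPDE.kato_solution_le_div_sqrt` (`RusinSverakLeraySolutions.lean`;
Kato 1984, Thm. 1; Lemarié-Rieusset 2016, proof of Thm. 15.1 (A), PDF p. 565: for the mild
solution `u ∈ C([0,T*), L³)`, "`√t u` is bounded on `(0,S) × ℝ³`" for every `S < T*`). The tree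
reduced it to Kato's weighted local existence theorem alone
(`kato_solution_le_div_sqrt_of_kato_local_L3`, `RusinSverakLeraySolutionsProofs.lean`, the
restart fact being discharged), and `kato_local_L3` is now proved (`kato_local_L3_holds`,
`KatoLocalL3Exists.lean`: Picard iteration on the Oseen–Koch–Tataru kernel in Kato's weighted
class, `KatoPicard.lean`, continuity in `L³`, `KatoMildContinuity.lean`, and the duality form,
`KatoL3FixedPointClass.lean`). Kept in a leaf file: `KatoLocalL3Exists.lean` imports
`MildL3Smooth.lean` through `KatoLocalL3Scaling.lean`, as does `RusinSverakLeraySolutionsProofs.lean`.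

## References

* T. Kato, *Strong `L^p`-solutions of the Navier–Stokes equation in `ℝ^m`, with applications to
  weak solutions*, Math. Z. 187 (1984) 471–480, Thm. 1. [Kato1984]
* P. G. Lemarié-Rieusset, *The Navier–Stokes Problem in the 21st Century*, CRC Press 2016,
  doi:10.1201/b19556, proof of Thm. 15.1 (A), (C) (PDF p. 565); Thm. 7.5. [LemarieRieusset2016]
-/

noncomputable section

namespace Literature.Analysis.FluidPDE

/-- **Kato's weighted bound `‖u(t,x)‖ ≤ C/√t` for Kato solutions, proved** (Kato 1984, Thm. 1;
Lemarié-Rieusset 2016, proof of Thm. 15.1 (A), PDF p. 565): the named fact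
`kato_solution_le_div_sqrt` from `kato_solution_le_div_sqrt_of_kato_local_L3` and the discharged
`kato_local_L3_holds`. [cite: Kato1984, Thm. 1] [cite: LemarieRieusset2016, Thm. 15.1 (A) (proof, PDF p. 565)] -/
theorem kato_solution_le_div_sqrt_holds : kato_solution_le_div_sqrt :=
  kato_solution_le_div_sqrt_of_kato_local_L3 kato_local_L3_holds

end Literature.Analysis.FluidPDE

end
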